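import Summits.QuantumFields.YangMills.Theorems.AllWindowsColdBoxBoxHighLineStep2Wick
import Summits.QuantumFields.YangMills.Theorems.AllWindowsColdBoxBoxHighLineEdgeChartGaussianMoments

/-!
# T-S5.11 `MainTermWick` BY NAME — `β² · Cov₀(|ℓ_{p₀}|², |ℓ_{p_T}|²) = (3/4) · boxDirCircSqCov H T`

Planner ym-idea-2 g18's task Prop `MainTermWick` (`Cruxes/BoxHighWindowsSU22/TaskS5Step2Wick.lean` → ✓`…Theorems.AllWindowsColdBoxBoxHighLineStep2Wick`,
w3 g40's byte-for-byte copy): under the Hodge Gaussian `gaussWeight β H a = exp(−β·boxQuadForm H a)` of the edge chart, the connected two-point function of the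
quadratic plaquette costs `linCurvSq H p a = Σ_c (landauCoeff H p ⬝ᵥ colour a c)²` at `p₀ = plaq12At (boxCentre H)` and its `T·e₀` translate is EXACTLY
`(3/4)·boxDirCircSqCov H T / β²`, for every `H ≥ 1`, `β > 0`, `T`.

Proof: this is ✓`EdgeChartGaussian.edgeChart_secondOrder_cov_main` (✓p739592, `…EdgeChartGaussianMoments`), whose statement is the same with
`gaussCov`/`gaussAvg`/`gaussWeight`/`linCurvSq`/`linCurv`/`colour`/`boxQuadForm` unfolded — the bridge is definitional.

HONEST LABEL: T-S5.11 is ONE support brick (the Gaussian main term) of STEP 2 of the XL stub S5 (`stub_landauSecondOrder`) of the critic-PASSed DRAFT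
line LINE-19; C1/C2 corrections, T-S5.10/12/13, S5, U5, ⟨stmt-QuantumFields-24004⟩ ⟨24335⟩ ⟨24336⟩ remain OPEN; route AllWindowsColdBox is DRAFT; no rung
is proved; the Yang–Mills mass gap is NOT proved by this file; no summit is proved by a line.  Seat ym-line-sfw-p2 g77 (LEAD, cell ym-idea-1; Wick layer).
-/

set_option autoImplicit false

noncomputable section

open MeasureTheory Matrix Finset

namespace Summit.QuantumFields.YangMills.Theorems.AllWindowsColdBoxBoxHighLine

/-- ★★ **T-S5.11 `MainTermWick`, by name**: `β² · Cov₀(|ℓ_{p₀}|², |ℓ_{p_T}|²) = (3/4) · boxDirCircSqCov H T` for all `H ≥ 1`, `β > 0`, `T`. -/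
theorem mainTermWick : MainTermWick := fun H hH _β hβ T =>
  EdgeChartGaussian.edgeChart_secondOrder_cov_main H hH hβ T

end Summit.QuantumFields.YangMills.Theorems.AllWindowsColdBoxBoxHighLine

end
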